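import Summits.CriticalPhenomena.Ising3DConformalLimit.Theorems.MirrorHoelderCompactnessTwoPointDoublingStubLeanScalePropagation
import Summits.CriticalPhenomena.Ising3DConformalLimit.Theorems.HyperoctahedralRPExistsScaleCovariantLimitFoldedCurrentSqrtDoublingBoxSum
import Literature.Probability.LatticeModels.PointwiseScalingLimitEtaExists
import HarnessLib

/-!
# The critical axis profile satisfies Duminil-Copin–Panis Theorem 1.3 in profile form
# (crux stmt-CriticalPhenomena-1981, line folded-current-repulsion, stub `axis_dcp_profile`)

On `ℤ³` at `β_c`, write `g(k) = ⟨σ₀σ_{k e₀}⟩⁺ = criticalTwoPoint 3 (Pi.single 0 k)` and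
`χ_M = Σ_{‖x‖_∞ ≤ M} ⟨σ₀σ_x⟩⁺` (`box 3 M`). Duminil-Copin–Panis, Theorem 1.3 at `d = 3`, `β = β_c`
(proved in the tree: `dcp_axis_lower_three`) gives `c₁ > 0` and `N₁` with
`g(m) ≥ c₁ / (χ_{4m} + m Σ_{k ≤ 2m} k g(k))` for all `m ≥ N₁`. Bounding the box susceptibility by the axis
profile (`box_sum_le_axis_sum`: `χ_M ≤ 1 + Σ_{k ≤ M} 54 k² g(k)`, sup-norm Messager–Miracle-Solé plus shell
counting) puts this in the PROFILE form used by the barrier of the line: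

`c ≤ g(n) · (1 + Σ_{k ≤ 4n} k² g(k) + n Σ_{k ≤ 2n} k g(k))` for every `n ≥ 1`,

with `c = min (c₁ / 54) (g N₁) > 0`; the scales `n < N₁` are handled by axis monotonicity
(`criticalTwoPoint_axis_antitone`) and positivity (`criticalTwoPoint_axis_pos`).

## References

* H. Duminil-Copin, R. Panis, *New lower bounds for the (near) critical Ising and φ⁴ models' two-point
  functions*, Comm. Math. Phys. 406 (2025), arXiv:2404.05700, Theorem 1.3 [DuminilCopinPanis2025LowerBounds].
* A. Messager, S. Miracle-Solé, J. Stat. Phys. 17 (1977) 245 [MessagerMiracleSoleJSP1977].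
-/

noncomputable section

open Finset
open scoped BigOperators
open Literature.Probability.LatticeModels

namespace Summit.CriticalPhenomena.Ising3DConformalLimit.Cruxes.ExistsScaleCovariantLimit.FoldedCurrentRepulsion

open Summit.CriticalPhenomena.Ising3DConformalLimit.Cruxes.TwoPointDoubling.Birth (dcp_axis_lower_three)

/-- **The Duminil-Copin–Panis denominator against the axis profile.** For every `m`,
`χ_{4m} + m Σ_{k ≤ 2m} k g(k) ≤ 54 · (1 + Σ_{k ≤ 4m} k² g(k) + m Σ_{k ≤ 2m} k g(k))`: the box susceptibility is
at most `1 + Σ_{k ≤ 4m} 54 k² g(k)` (`box_sum_le_axis_sum`, sup-norm Messager–Miracle-Solé and shell counting) and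
all summands are nonnegative (Griffiths).
[cite: MessagerMiracleSoleJSP1977, main theorem (monotonicity of ⟨σ₀σ_x⟩ under reflections)] -/
theorem dcp_denominator_le_profile (m : ℕ) :
    (∑ x ∈ box 3 (4 * m), criticalTwoPoint 3 x) +
        (m : ℝ) * ∑ k ∈ Icc 1 (2 * m), (k : ℝ) * criticalTwoPoint 3 (Pi.single 0 (k : ℤ)) ≤
      54 * (1 + ∑ k ∈ Icc 1 (4 * m), (k : ℝ) ^ 2 * criticalTwoPoint 3 (Pi.single 0 (k : ℤ)) +
        (m : ℝ) * ∑ k ∈ Icc 1 (2 * m), (k : ℝ) * criticalTwoPoint 3 (Pi.single 0 (k : ℤ))) := by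
  have hbox := box_sum_le_axis_sum (4 * m)
  have e54 : ∑ k ∈ Icc 1 (4 * m), 54 * (k : ℝ) ^ 2 * criticalTwoPoint 3 (Pi.single 0 (k : ℤ)) =
      54 * ∑ k ∈ Icc 1 (4 * m), (k : ℝ) ^ 2 * criticalTwoPoint 3 (Pi.single 0 (k : ℤ)) := by
    rw [Finset.mul_sum]
    refine Finset.sum_congr rfl fun k _ => ?_
    ring
  have hS2 : 0 ≤ ∑ k ∈ Icc 1 (4 * m), (k : ℝ) ^ 2 * criticalTwoPoint 3 (Pi.single 0 (k : ℤ)) :=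
    Finset.sum_nonneg fun k _ => mul_nonneg (by positivity) (criticalTwoPoint_nonneg' _)
  have hS1 : 0 ≤ (m : ℝ) * ∑ k ∈ Icc 1 (2 * m), (k : ℝ) * criticalTwoPoint 3 (Pi.single 0 (k : ℤ)) :=
    mul_nonneg (by positivity)
      (Finset.sum_nonneg fun k _ => mul_nonneg (by positivity) (criticalTwoPoint_nonneg' _))
  rw [e54] at hbox
  linarith

/-- **The Duminil-Copin–Panis denominator is positive**: `0 < χ_{4m} + m Σ_{k ≤ 2m} k g(k)`, since the box
sum contains the origin term `⟨σ₀σ₀⟩ = 1` and every summand is nonnegative (Griffiths). [folklore] -/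
theorem dcp_denominator_pos (m : ℕ) :
    0 < (∑ x ∈ box 3 (4 * m), criticalTwoPoint 3 x) +
        (m : ℝ) * ∑ k ∈ Icc 1 (2 * m), (k : ℝ) * criticalTwoPoint 3 (Pi.single 0 (k : ℤ)) := by
  have h0 : (1 : ℝ) ≤ ∑ x ∈ box 3 (4 * m), criticalTwoPoint 3 x := by
    have hmem : (0 : Site 3) ∈ box 3 (4 * m) := Literature.Probability.LatticeModels.zero_mem_box 3 (4 * m)
    have h := Finset.single_le_sum (f := fun x => criticalTwoPoint 3 x)
      (fun x _ => criticalTwoPoint_nonneg' x) hmem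
    rw [criticalTwoPoint_zero'] at h
    exact h
  have h1 : 0 ≤ (m : ℝ) * ∑ k ∈ Icc 1 (2 * m), (k : ℝ) * criticalTwoPoint 3 (Pi.single 0 (k : ℤ)) :=
    mul_nonneg (by positivity)
      (Finset.sum_nonneg fun k _ => mul_nonneg (by positivity) (criticalTwoPoint_nonneg' _))
  linarith

/-- **Duminil-Copin–Panis Theorem 1.3 in profile form (stub `axis_dcp_profile` of line
`folded-current-repulsion`, crux stmt-CriticalPhenomena-1981).** There is `c₁ > 0` with
`c₁ ≤ g(n) · (1 + Σ_{k ≤ 4n} k² g(k) + n Σ_{k ≤ 2n} k g(k))` for every `n ≥ 1`, where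
`g(k) = ⟨σ₀σ_{k e₀}⟩⁺_{β_c(3)} = criticalTwoPoint 3 (Pi.single 0 k)`: for `n ≥ N₁` this is Theorem 1.3
(`dcp_axis_lower_three`) with its denominator bounded by `54 ×` the profile (`dcp_denominator_le_profile`); for
`1 ≤ n < N₁`, `g(n) ≥ g(N₁) > 0` by axis monotonicity and positivity while the profile is `≥ 1`. The constant is
`min (c₁ / 54) (g N₁)`. [cite: DuminilCopinPanis2025LowerBounds, Theorem 1.3] -/
theorem axis_dcp_profile : ∃ c₁ : ℝ, 0 < c₁ ∧ ∀ n : ℕ, 1 ≤ n → c₁ ≤ Literature.Probability.LatticeModels.criticalTwoPoint 3 (Pi.single 0 (n : ℤ)) * (1 + ∑ k ∈ Finset.Icc 1 (4 * n), (k : ℝ) ^ 2 * Literature.Probability.LatticeModels.criticalTwoPoint 3 (Pi.single 0 (k : ℤ)) + (n : ℝ) * ∑ k ∈ Finset.Icc 1 (2 * n), (k : ℝ) * Literature.Probability.LatticeModels.criticalTwoPoint 3 (Pi.single 0 (k : ℤ))) := by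
  obtain ⟨c₁, hc₁, N₁, _hN₁, hdcp⟩ := dcp_axis_lower_three
  refine ⟨min (c₁ / 54) (criticalTwoPoint 3 (Pi.single 0 (N₁ : ℤ))),
    lt_min (by positivity) (criticalTwoPoint_axis_pos N₁), fun n _hn => ?_⟩
  -- nonnegativity of the level and of the two profile sums
  have hgn : 0 ≤ criticalTwoPoint 3 (Pi.single 0 (n : ℤ)) := criticalTwoPoint_nonneg' _
  have hS2 : 0 ≤ ∑ k ∈ Icc 1 (4 * n), (k : ℝ) ^ 2 * criticalTwoPoint 3 (Pi.single 0 (k : ℤ)) :=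
    Finset.sum_nonneg fun k _ => mul_nonneg (by positivity) (criticalTwoPoint_nonneg' _)
  have hS1 : 0 ≤ (n : ℝ) * ∑ k ∈ Icc 1 (2 * n), (k : ℝ) * criticalTwoPoint 3 (Pi.single 0 (k : ℤ)) :=
    mul_nonneg (by positivity)
      (Finset.sum_nonneg fun k _ => mul_nonneg (by positivity) (criticalTwoPoint_nonneg' _))
  rcases Nat.lt_or_ge n N₁ with hsmall | hlarge
  · -- small scales `n < N₁`: `g(n) ≥ g(N₁)` and the profile is `≥ 1`
    have hmono : criticalTwoPoint 3 (Pi.single 0 (N₁ : ℤ)) ≤ criticalTwoPoint 3 (Pi.single 0 (n : ℤ)) :=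
      criticalTwoPoint_axis_antitone hsmall.le
    have hmin := min_le_right (c₁ / 54) (criticalTwoPoint 3 (Pi.single 0 (N₁ : ℤ)))
    linarith [mul_nonneg hgn hS2, mul_nonneg hgn hS1]
  · -- large scales `n ≥ N₁`: Theorem 1.3 at scale `n`, denominator against the profile
    have hD := hdcp n hlarge
    have hc1 := (div_le_iff₀ (dcp_denominator_pos n)).1 hD
    have hc2 := hc1.trans (mul_le_mul_of_nonneg_left (dcp_denominator_le_profile n) hgn)
    have hmin := min_le_left (c₁ / 54) (criticalTwoPoint 3 (Pi.single 0 (N₁ : ℤ)))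
    linarith

end Summit.CriticalPhenomena.Ising3DConformalLimit.Cruxes.ExistsScaleCovariantLimit.FoldedCurrentRepulsion

end
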